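/-
Copyright (c) 2026 the pub-hodgecm-mathlib formalisation cell (harness21).  Prover seat hodgecm-mathlib-K2Liu-p01 (g5): Track B «K2-LIT»,
#184♮ = hLiu418 = stmt-HodgeConjecture-24832, road `K2_Liu`, socket #41 `sig_K2LiuSiegelEisensteinContinuation`, ROAD Φ organ Φ8a
«LOCAL INTERTWINING PROPERTY» (CENSUS-41 §7, `K2/K2E5-plan/g5/CENSUS-41-SiegelEisensteinContinuation.K2E5-plan-g5.md`; LEAD F0P6-plan (g11)
deal (S4) 2026-09-04T05:34:11Z ∕ 05:45:00Z).
-/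
import Summits.HodgeConjecture.HodgeConjecture.Theorems.K2LiuSiegelLeviWeylAlgebra        -- ★ `adapt_matA_conj_nElem`, `isSiegelDelta_weylDelta_conj`, `detDelta_weylDelta_conj`
import Summits.HodgeConjecture.HodgeConjecture.Theorems.K2LiuUnipDeltaLocalCoordinates     -- ★ `eq_nElem_of_mem_unipDeltaLocal`
import Summits.HodgeConjecture.HodgeConjecture.Theorems.K2LiuLocalSiegelCharacterMul       -- ★ `K2LiuLocalSiegel.{detDelta_mul, absDetDelta_mul, chiDet_mul, isUnit_detDelta}`
import Literature.NumberTheory.Automorphic.AdelicVectorHeightGalois                        -- ★ `norm_galAdicCompletionMap`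
import HarnessLib

/-!
# Crux `HLiu418`, road `K2_Liu`, socket #41, ROAD Φ organ Φ8a: THE LOCAL INTERTWINING PROPERTY —
# `M_v(s) : I_v(s, χ_v) → I_v(−s, χ′_v)`, `χ′ = (χ ∘ c)⁻¹`, GIVEN the modulus of `P_Δ(F_v)` on `N_Δ(F_v)`

Cell `hodgecm-mathlib`, crux item hLiu418 = `stmt-HodgeConjecture-24832`; squad K2 ∕ K2Liu; prover K2Liu-p01 (g5).  THEOREMS ONLY (no `def`,
no `instance`, no notation, no named-fact hypothesis, no `sorry`); lane `--supports stmt-HodgeConjecture-24832` (count-neutral helper).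

THE MATHEMATICS ([Casselman1980, §3]; [HarrisKudlaSweet1996, §1 (1.11)–(1.15), §6 (6.14)]; [MoeglinWaldspurger1995, II.1.6]; [GelbartPiatetskiShapiroRallis1987,
Part A §5]).  `H(F_v) = U(𝕍 ⊕ −𝕍)(F_v)` (★ `UnitaryGroup.localPi E c (n + n) J^𝔻 v`), `P_Δ = M_Δ N_Δ` its Siegel parabolic (★ `IsSiegelDelta`,
★ D10 `unipDeltaLocal`), `w_Δ` (★ `weylDelta`), `M_v f (h) = ∫_{N_Δ(F_v)} f(w_Δ u h) dνN(u)` (★ D10 `localIntertwining`, `νN` ANY left-invariant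
measure on `N_Δ(F_v)`).  For a Siegel section `f` of `I_v(s, χ_v)` (★ D1 `IsLocalSiegelSection`: `f(p h) = χ_v(det_Δ p)|det_Δ p|_v^{s+n/2} f(h)`)
and `p ∈ P_Δ(F_v)`:
* §1 `P_Δ` normalises `N_Δ` (`conj_mem_unipDeltaLocal`, from ★ `adapt_matA_conj_nElem` + ★ `eq_nElem_of_mem_unipDeltaLocal`); the conjugation
  `u ↦ q u q⁻¹` is a homeomorphism of `N_Δ(F_v)` (`exists_homeomorph_conj`).
* §2 THE LEVI DECOMPOSITION `p = m · n(A⁻¹B)`: `A⁻¹B` is `T₀`-skew (`skew_blkA_inv_mul_blkB`, ★ `rel₁₂`∕`rel₂₂` of ★ `cstar_matA`), and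
  `m := p · n(A⁻¹B)⁻¹` is a LEVI element: `adapt (matA m) = diag(A, D)` (`adapt_matA_leviPart`).
* §3 the Weyl conjugate of the inducing character: `σ(det A) · det D = 1` on `P_Δ` (`map_det_blkA_mul_det_blkD`), hence for a Levi `m`
  `|det_Δ (w_Δ m w_Δ)|_v = |det_Δ m|_v⁻¹` (`absDetDelta_weylDelta_conj`, ★ `norm_galAdicCompletionMap`) and
  `χ_v(det_Δ (w_Δ m w_Δ)) = χ′_v(det_Δ m)` (`chiDet_weylDelta_conj`) for ANY family `χ′_w = (χ_{w′})⁻¹ ∘ c_w` (`c • w = w′`; for a Hecke character this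
  is ★ `HeckeCharacter.localComponent_galConj_inv_eq_comp`, i.e. `χ′ = (χ ∘ c)⁻¹`), by re-indexing the places over `v` along `w ↦ c⁻¹ • w`.
* §4 **`isLocalSiegelSection_localIntertwining_of_modulus`** — GIVEN the modulus identity
  `hmod : (u ↦ q u q⁻¹)_* νN = |det_Δ q|_v^{−n} • νN` for `q ∈ P_Δ(F_v)` (the module of `Ad(q)` on `N_Δ(F_v) ≅ Herm_n(E_v)`; organ Φ8a (B),
  file `K2LiuUnipDeltaConjugationModulus`), `M_v f` IS a Siegel section of `I_v(−s, χ′_v)`: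
  `M_v f (p h) = |det_Δ p|^{n} · χ(det_Δ(w_Δ m w_Δ))|det_Δ(w_Δ m w_Δ)|^{s+n/2} · M_v f (h) = χ′(det_Δ p)|det_Δ p|^{−s+n/2} · M_v f (h)`
  (substitutions `u ↦ p⁻¹ u p` — a measurable equivalence scaled by `hmod` — and `u ↦ n(A⁻¹B) u` — left invariance; NO integrability hypothesis:
  both substitutions are valid for the junk value of the Bochner integral too).  This discharges the hypothesis `hM` of ★
  `K2LiuLocalIntertwiningSphericalReduction.localIntertwining_eq_apply_one_mul` with `s′ = −s`.
HONEST LABEL.  Count-neutral helper; it retires nothing by itself: `HC_CM` is proved only modulo the 7 printed citations (2 remaining named inputs: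
hLiu418 = `stmt-HodgeConjecture-24832`, h413 = `stmt-HodgeConjecture-24833`) until rung 0 closes.

## References
* [Casselman1980] W. Casselman, *The unramified principal series of p-adic groups I*, Compositio Math. 40 (1980): §3 (`T_w : I(χ) → I(wχ)`).
* [HarrisKudlaSweet1996] M. Harris, S. Kudla, W. J. Sweet, J. AMS 9 (1996): §1 (1.11)–(1.15), §6 (6.14) (`M(s) : I_n(s, χ) → I_n(−s, (χ ∘ c)⁻¹)`… ).
* [MoeglinWaldspurger1995] C. Mœglin, J.-L. Waldspurger, *Spectral decomposition and Eisenstein series*, CUP (1995): II.1.6.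
* [GelbartPiatetskiShapiroRallis1987] S. Gelbart, I. Piatetski-Shapiro, S. Rallis, LNM 1254 (1987): Part A §5.
-/

set_option autoImplicit false
set_option linter.dupNamespace false -- the mandated namespace repeats `HodgeConjecture.HodgeConjecture`

noncomputable section

open NumberField IsDedekindDomain Matrix MeasureTheory Topology
open scoped NNReal ENNReal
open Literature.NumberTheory.Automorphic Literature.NumberTheory.Automorphic.UnitaryGroup
open Literature.NumberTheory.GelbartRogawski1991.AdaptedBlocks
open Literature.NumberTheory.GelbartRogawski1991.UnitaryDualPair.LocalSplitting
open Literature.NumberTheory.K2Lit.LocalSiegelDoubled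
open Summit.HodgeConjecture.HodgeConjecture.Cruxes.HLiu418.K2LiuSiegelLeviWeylAlgebra
open Summit.HodgeConjecture.HodgeConjecture.Cruxes.HLiu418.K2LiuUnipDeltaLocalCoordinates
open Summit.HodgeConjecture.HodgeConjecture.Cruxes.HLiu418.K2LiuLocalSiegel

namespace Summit.HodgeConjecture.HodgeConjecture.Cruxes.HLiu418.K2LiuLocalIntertwiningProperty

variable (F : Type) [Field F] [NumberField F] (E : Type) [Field E] [NumberField E] [Algebra F E]
  [Algebra.IsQuadraticExtension F E] (c : E ≃ₐ[F] E)
  {δ : E} (hcδ : c δ = -δ) (hδ : δ ≠ 0) {d : F} (hd : δ * δ = algebraMap F E d)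
  (v : HeightOneSpectrum (𝓞 F)) (n : ℕ) {T₀ : Matrix (Fin n) (Fin n) F} (hT₀ : T₀.IsSymm) (hT₀d : IsUnit T₀.det)
  {JD : Matrix (Fin (n + n)) (Fin (n + n)) E} (hJD : JD = (gramD F n T₀).map (algebraMap F E))

/-! ## §1 `P_Δ(F_v)` normalises `N_Δ(F_v)`; the conjugation homeomorphism -/

include hcδ hδ hd hT₀ hJD in
/-- **`q u q⁻¹ ∈ N_Δ(F_v)` for `q ∈ P_Δ(F_v)`, `u ∈ N_Δ(F_v)`** (every `u` is an `n(t)`, ★ `eq_nElem_of_mem_unipDeltaLocal`, and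
`q n(t) q⁻¹ = n(A t D⁻¹)`, ★ `adapt_matA_conj_nElem`). [cite: HarrisKudlaSweet1996, §1 (1.12)] [cite: Kudla1994, §3] -/
theorem conj_mem_unipDeltaLocal {q : UnitaryGroup.localPi E c (n + n) JD v} (hq : IsSiegelDelta F E c hcδ hδ hd v n hT₀ hJD q)
    {u : UnitaryGroup.localPi E c (n + n) JD v} (hu : u ∈ unipDeltaLocal F E c v n (JD := JD)) :
    q * u * q⁻¹ ∈ unipDeltaLocal F E c v n (JD := JD) := by
  have hC := (isSiegelDelta_iff_blkC_eq_zero F E c hcδ hδ hd v n hT₀ hJD q).1 hq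
  rw [eq_nElem_of_mem_unipDeltaLocal F E c v n hJD hu]
  exact conj_nElem_mem_unipDeltaLocal F E c v n hJD hC _

include hcδ hδ hd hT₀ hJD in
/-- **the conjugation `u ↦ q u q⁻¹` is a HOMEOMORPHISM of `N_Δ(F_v)`** (`q ∈ P_Δ(F_v)`; inverse `u ↦ q⁻¹ u q`). [folklore] -/
theorem exists_homeomorph_conj {q : UnitaryGroup.localPi E c (n + n) JD v} (hq : IsSiegelDelta F E c hcδ hδ hd v n hT₀ hJD q) :
    ∃ e : unipDeltaLocal F E c v n (JD := JD) ≃ₜ unipDeltaLocal F E c v n (JD := JD),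
      ∀ u, e u = ⟨q * (u : UnitaryGroup.localPi E c (n + n) JD v) * q⁻¹, conj_mem_unipDeltaLocal F E c hcδ hδ hd v n hT₀ hJD hq u.2⟩ := by
  refine ⟨⟨⟨fun u => ⟨q * (u : UnitaryGroup.localPi E c (n + n) JD v) * q⁻¹, conj_mem_unipDeltaLocal F E c hcδ hδ hd v n hT₀ hJD hq u.2⟩,
    fun u => ⟨q⁻¹ * (u : UnitaryGroup.localPi E c (n + n) JD v) * q⁻¹⁻¹, conj_mem_unipDeltaLocal F E c hcδ hδ hd v n hT₀ hJD hq.inv u.2⟩,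
    fun u => Subtype.ext ?_, fun u => Subtype.ext ?_⟩, ?_, ?_⟩, fun u => rfl⟩
  · show q⁻¹ * (q * (u : UnitaryGroup.localPi E c (n + n) JD v) * q⁻¹) * q⁻¹⁻¹ = u
    rw [inv_inv]; group
  · show q * (q⁻¹ * (u : UnitaryGroup.localPi E c (n + n) JD v) * q⁻¹⁻¹) * q⁻¹ = u
    rw [inv_inv]; group
  · exact Continuous.subtype_mk ((continuous_const.mul continuous_subtype_val).mul continuous_const) _
  · exact Continuous.subtype_mk ((continuous_const.mul continuous_subtype_val).mul continuous_const) _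


/-! ## §2 The Levi decomposition `p = m · n(A⁻¹B)` of `P_Δ(F_v)` -/

omit [Algebra.IsQuadraticExtension F E] in
include hJD hT₀d in
/-- **`σ(det A) · det D = 1` on `P_Δ(F_v)`** (from the `(1,2)` unitarity relation `σ(A)ᵀ T D = T` of ★ `cstar_matA` with `C = 0`; the twin of ★
`map_det_blkD_mul_det_blkA'`). [cite: HarrisKudlaSweet1996, §1 (1.11)–(1.12)] -/
theorem map_det_blkA_mul_det_blkD {p : UnitaryGroup.localPi E c (n + n) JD v} (hC : blkC (matA F E c v n p) = 0) :
    conjLocal E c v (blkA (matA F E c v n p)).det * (blkD (matA F E c v n p)).det = 1 := by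
  have h := rel₁₂ (cstar_matA F E c v n hJD p)
  rw [hC, Matrix.map_zero _ (map_zero _), Matrix.transpose_zero, Matrix.zero_mul, Matrix.zero_mul, zero_add] at h
  have hdet := congrArg Matrix.det h
  rw [Matrix.det_mul, Matrix.det_mul, Matrix.det_transpose, ← RingHom.mapMatrix_apply, ← RingHom.map_det] at hdet
  have h2 : conjLocal E c v (blkA (matA F E c v n p)).det * (blkD (matA F E c v n p)).det * (gramS F E v n T₀).det =
      1 * (gramS F E v n T₀).det := by
    rw [one_mul, mul_right_comm]; exact hdet
  exact (isUnit_det_gramS' F E v n hT₀d).mul_right_cancel h2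

omit [Algebra.IsQuadraticExtension F E] in
include hJD in
/-- **`A⁻¹B` is `T₀`-skew for `p ∈ P_Δ(F_v)`**: `σ(A⁻¹B)ᵀ T + T A⁻¹B = 0` (from `σ(A)ᵀ T D = T`, `σ(D)ᵀ T A = T` and
`σ(D)ᵀ T B + σ(B)ᵀ T D = 0`, ★ `rel₁₂`∕`rel₂₁`∕`rel₂₂` with `C = 0`). [cite: HarrisKudlaSweet1996, §1 (1.11)–(1.12)] -/
theorem skew_blkA_inv_mul_blkB {p : UnitaryGroup.localPi E c (n + n) JD v} (hC : blkC (matA F E c v n p) = 0) :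
    (((blkA (matA F E c v n p))⁻¹ * blkB (matA F E c v n p)).map (conjLocal E c v))ᵀ * gramS F E v n T₀ +
        gramS F E v n T₀ * ((blkA (matA F E c v n p))⁻¹ * blkB (matA F E c v n p)) = 0 := by
  obtain ⟨hAu, -⟩ := isUnit_det_blkA_blkD F E c v n hC
  have hM := cstar_matA F E c v n hJD p
  have h12 := rel₁₂ hM
  have h21 := rel₂₁ hM
  have h22 := rel₂₂ hM
  rw [hC, Matrix.map_zero _ (map_zero _), Matrix.transpose_zero, Matrix.zero_mul, Matrix.zero_mul, zero_add] at h12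
  rw [hC, Matrix.mul_zero, add_zero] at h21
  set A := blkA (matA F E c v n p)
  set B := blkB (matA F E c v n p)
  set D := blkD (matA F E c v n p)
  set T := gramS F E v n T₀
  -- `σ(A⁻¹)ᵀ = (σ(A)ᵀ)⁻¹`
  have hσAinvT : ((A⁻¹).map (conjLocal E c v))ᵀ = ((A.map (conjLocal E c v))ᵀ)⁻¹ := by
    refine (Matrix.inv_eq_right_inv ?_).symm
    rw [← Matrix.transpose_mul, ← Matrix.map_mul, Matrix.nonsing_inv_mul _ hAu, Matrix.map_one _ (map_zero _) (map_one _),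
      Matrix.transpose_one]
  -- `T A⁻¹ = σ(D)ᵀ T` (from `σ(D)ᵀ T A = T`) and `σ(A)⁻ᵀ T = T D` (from `σ(A)ᵀ T D = T`)
  have hTAinv : T * A⁻¹ = (D.map (conjLocal E c v))ᵀ * T := by
    have h := congrArg (· * A⁻¹) h21
    simp only [Matrix.mul_assoc, Matrix.mul_nonsing_inv _ hAu, Matrix.mul_one] at h
    exact h.symm
  have hσAT : ((A.map (conjLocal E c v))ᵀ)⁻¹ * T = T * D := by
    have hσATu : IsUnit ((A.map (conjLocal E c v))ᵀ).det := by
      rw [Matrix.det_transpose, ← RingHom.mapMatrix_apply, ← RingHom.map_det]; exact hAu.map _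
    have h := congrArg (((A.map (conjLocal E c v))ᵀ)⁻¹ * ·) h12
    simp only [← Matrix.mul_assoc, Matrix.nonsing_inv_mul _ hσATu, Matrix.one_mul] at h
    exact h.symm
  rw [Matrix.map_mul, Matrix.transpose_mul, hσAinvT, ← Matrix.mul_assoc, hTAinv, Matrix.mul_assoc ((B.map (conjLocal E c v))ᵀ), hσAT,
    add_comm, ← Matrix.mul_assoc]
  exact h22

omit [Algebra.IsQuadraticExtension F E] in
include hJD in
/-- **THE LEVI PART `m := p · n(A⁻¹B)⁻¹` of `p ∈ P_Δ(F_v)` has adapted matrix `diag(A, D)`** (`[[A,B],[0,D]] · [[1,−A⁻¹B],[0,1]] = [[A,0],[0,D]]`).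
[cite: HarrisKudlaSweet1996, §1 (1.11)] [cite: MoeglinWaldspurger1995, II.1.6] -/
theorem adapt_matA_leviPart {p : UnitaryGroup.localPi E c (n + n) JD v} (hC : blkC (matA F E c v n p) = 0) :
    adapt (matA F E c v n (p * (nElem F E c v n hJD _ (skew_blkA_inv_mul_blkB F E c v n hJD hC))⁻¹)) =
      Matrix.fromBlocks (blkA (matA F E c v n p)) 0 0 (blkD (matA F E c v n p)) := by
  obtain ⟨hAu, -⟩ := isUnit_det_blkA_blkD F E c v n hC
  rw [nElem_inv, ← matA_mul, adapt_mul, adapt_matA_nElem, adapt_eq (matA F E c v n p), hC, Matrix.fromBlocks_multiply]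
  simp only [Matrix.mul_one, Matrix.zero_mul, Matrix.mul_zero, add_zero, zero_add, Matrix.mul_neg, neg_zero, ← Matrix.mul_assoc,
    Matrix.mul_nonsing_inv _ hAu, Matrix.one_mul, neg_add_cancel]

omit [Algebra.IsQuadraticExtension F E] in
include hJD in
/-- the blocks of the Levi part: `A(m) = A`, `B(m) = 0`, `C(m) = 0`, `D(m) = D`. [cite: HarrisKudlaSweet1996, §1 (1.11)] -/
theorem blocks_matA_leviPart {p : UnitaryGroup.localPi E c (n + n) JD v} (hC : blkC (matA F E c v n p) = 0) :
    blkA (matA F E c v n (p * (nElem F E c v n hJD _ (skew_blkA_inv_mul_blkB F E c v n hJD hC))⁻¹)) = blkA (matA F E c v n p) ∧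
      blkB (matA F E c v n (p * (nElem F E c v n hJD _ (skew_blkA_inv_mul_blkB F E c v n hJD hC))⁻¹)) = 0 ∧
      blkC (matA F E c v n (p * (nElem F E c v n hJD _ (skew_blkA_inv_mul_blkB F E c v n hJD hC))⁻¹)) = 0 ∧
      blkD (matA F E c v n (p * (nElem F E c v n hJD _ (skew_blkA_inv_mul_blkB F E c v n hJD hC))⁻¹)) = blkD (matA F E c v n p) := by
  have h := adapt_matA_leviPart F E c v n hJD hC
  rw [adapt_eq] at h
  obtain ⟨h1, h2, h3, h4⟩ := Matrix.fromBlocks_inj.1 h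
  exact ⟨h1, h2, h3, h4⟩

include hcδ hδ hd hT₀ hJD in
/-- the Levi part lies in `P_Δ(F_v)`. [cite: HarrisKudlaSweet1996, §1 (1.11)] -/
theorem isSiegelDelta_leviPart {p : UnitaryGroup.localPi E c (n + n) JD v} (hp : IsSiegelDelta F E c hcδ hδ hd v n hT₀ hJD p) :
    IsSiegelDelta F E c hcδ hδ hd v n hT₀ hJD
      (p * (nElem F E c v n hJD _ (skew_blkA_inv_mul_blkB F E c v n hJD
        ((isSiegelDelta_iff_blkC_eq_zero F E c hcδ hδ hd v n hT₀ hJD p).1 hp)))⁻¹) :=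
  hp.mul (isSiegelDelta_nElem F E c hcδ hδ hd v n hT₀ hJD _ _).inv

/-! ## §3 The Weyl conjugate of the inducing character: `|det_Δ(w_Δ m w_Δ)| = |det_Δ m|⁻¹`, `χ(det_Δ(w_Δ m w_Δ)) = χ′(det_Δ m)` -/

omit [Algebra.IsQuadraticExtension F E] in
/-- re-indexing a product over the places `w ∣ v` along the permutation `w ↦ c⁻¹ • w`. [folklore] -/
theorem prod_invSmulPlace {M : Type*} [CommMonoid M] (f : PlacesOver E v → M) :
    ∏ w : PlacesOver E v, f ⟨c⁻¹ • w.1, under_inv_smul_eq c w⟩ = ∏ w : PlacesOver E v, f w := by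
  refine Fintype.prod_equiv ⟨fun w : PlacesOver E v => (⟨c⁻¹ • w.1, under_inv_smul_eq c w⟩ : PlacesOver E v),
    fun w => ⟨c • w.1, by rw [HeightOneSpectrum.under_algEquiv_smul]; exact w.2⟩,
    fun w => Subtype.ext (smul_inv_smul c w.1), fun w => Subtype.ext (inv_smul_smul c w.1)⟩ _ f fun w => rfl

omit [Algebra.IsQuadraticExtension F E] in
include hJD hT₀d in
/-- on `P_Δ(F_v)`: `(c ⊗ 1)(det A)_w · (det D)_w = 1` at every `w ∣ v`. [cite: HarrisKudlaSweet1996, §1 (1.11)–(1.12)] -/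
theorem conjLocal_det_blkA_apply_mul {p : UnitaryGroup.localPi E c (n + n) JD v} (hC : blkC (matA F E c v n p) = 0) (w : PlacesOver E v) :
    conjLocal E c v (blkA (matA F E c v n p)).det w * (blkD (matA F E c v n p)).det w = 1 := by
  have h := congrFun (map_det_blkA_mul_det_blkD F E c v n hT₀d hJD hC) w
  rwa [Pi.mul_apply, Pi.one_apply] at h

omit [Algebra.IsQuadraticExtension F E] in
include hJD hT₀d in
/-- **`|det_Δ (w_Δ m w_Δ)|_v = |det_Δ m|_v⁻¹` for a Levi element `m`** (`det_Δ(w_Δ m w_Δ) = det D`, `det_Δ m = det A`, `σ(det A)·det D = 1`, and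
`c_w : E_{c⁻¹w} → E_w` is an isometry, ★ `norm_galAdicCompletionMap`). [cite: HarrisKudlaSweet1996, §1 (1.15)] [cite: MoeglinWaldspurger1995, II.1.6] -/
theorem absDetDelta_weylDelta_conj {m : UnitaryGroup.localPi E c (n + n) JD v} (hC : blkC (matA F E c v n m) = 0) (hB : blkB (matA F E c v n m) = 0) :
    absDetDelta F E c v n (weylDelta F E c v n hJD * m * weylDelta F E c v n hJD) = (absDetDelta F E c v n m)⁻¹ := by
  unfold absDetDelta
  simp only [detDelta_weylDelta_conj F E c v n hJD hC hB, detDelta_levi F E c v n hC]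
  have hw : ∀ w : PlacesOver E v, ‖(blkD (matA F E c v n m)).det w‖ = ‖(blkA (matA F E c v n m)).det ⟨c⁻¹ • w.1, under_inv_smul_eq c w⟩‖⁻¹ := by
    intro w
    have h := conjLocal_det_blkA_apply_mul F E c v n hT₀d hJD hC w
    rw [conjLocal_apply] at h
    rw [eq_inv_of_mul_eq_one_right h, norm_inv, norm_galAdicCompletionMap]
  simp only [hw]
  rw [Finset.prod_inv_distrib, prod_invSmulPlace F E c v (fun w => ‖(blkA (matA F E c v n m)).det w‖)]

omit [Algebra.IsQuadraticExtension F E] in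
include hJD hT₀d in
/-- **`χ_v(det_Δ (w_Δ m w_Δ)) = χ′_v(det_Δ m)` for a Levi element `m`** and ANY family with `χ′_w = (χ_{w′})⁻¹ ∘ c_w` (`c • w = w′`) — for the local
components of a Hecke character `χ` this is `χ′ = (χ ∘ c)⁻¹` (★ `HeckeCharacter.localComponent_galConj_inv_eq_comp`): the source of
`M(s) : I(s, χ) → I(−s, (χ ∘ c)⁻¹)`. [cite: HarrisKudlaSweet1996, §1 (1.15), §6 (6.14)] [cite: MoeglinWaldspurger1995, II.1.6] -/
theorem chiDet_weylDelta_conj (χv χv' : ∀ w : PlacesOver E v, (w.1.adicCompletion E)ˣ →* ℂˣ)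
    (hχ' : ∀ (w w' : PlacesOver E v) (h : c • w.1 = w'.1),
      χv' w = (χv w')⁻¹.comp (Units.map (galAdicCompletionMap (L := E) c h : w.1.adicCompletion E →* w'.1.adicCompletion E)))
    {m : UnitaryGroup.localPi E c (n + n) JD v} (hC : blkC (matA F E c v n m) = 0) (hB : blkB (matA F E c v n m) = 0) :
    chiDet F E c v n χv (weylDelta F E c v n hJD * m * weylDelta F E c v n hJD) = chiDet F E c v n χv' m := by
  classical
  unfold chiDet
  rw [← prod_invSmulPlace F E c v (fun w => if hu : IsUnit (detDelta F E c v n w m) then χv' w hu.unit else 1)]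
  refine Finset.prod_congr rfl fun w _ => ?_
  have hrel := conjLocal_det_blkA_apply_mul F E c v n hT₀d hJD hC w
  rw [conjLocal_apply] at hrel
  have hD : IsUnit (detDelta F E c v n w (weylDelta F E c v n hJD * m * weylDelta F E c v n hJD)) := by
    rw [detDelta_weylDelta_conj F E c v n hJD hC hB]; exact IsUnit.of_mul_eq_one_right _ hrel
  have hA : IsUnit (detDelta F E c v n ⟨c⁻¹ • w.1, under_inv_smul_eq c w⟩ m) := by
    rw [detDelta_levi F E c v n hC, isUnit_iff_ne_zero]
    intro h0
    rw [h0, map_zero, zero_mul] at hrel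
    exact zero_ne_one hrel
  rw [dif_pos hD, dif_pos hA, hχ' ⟨c⁻¹ • w.1, under_inv_smul_eq c w⟩ w (smul_inv_smul c w.1), MonoidHom.comp_apply, MonoidHom.inv_apply]
  have hunits : Units.map (galAdicCompletionMap (L := E) c (smul_inv_smul c w.1) :
      (⟨c⁻¹ • w.1, under_inv_smul_eq c w⟩ : PlacesOver E v).1.adicCompletion E →* w.1.adicCompletion E) hA.unit = hD.unit⁻¹ := by
    refine Units.ext ?_
    rw [Units.coe_map, MonoidHom.coe_coe, IsUnit.unit_spec, Units.val_inv_eq_inv_val, IsUnit.unit_spec,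
      detDelta_weylDelta_conj F E c v n hJD hC hB, detDelta_levi F E c v n hC]
    exact eq_inv_of_mul_eq_one_left hrel
  rw [hunits, map_inv, inv_inv]

/-! ## §4 The local intertwining property, GIVEN the modulus of `P_Δ(F_v)` on `N_Δ(F_v)` -/

omit [Algebra.IsQuadraticExtension F E] in
/-- `|det_Δ 1|_v = 1`. [cite: HarrisKudlaSweet1996, §1 (1.15)] -/
theorem absDetDelta_one : absDetDelta F E c v n (1 : UnitaryGroup.localPi E c (n + n) JD v) = 1 := by
  unfold absDetDelta detDelta
  exact Finset.prod_eq_one fun w _ => by rw [deltaBlock_one, Matrix.det_one, norm_one]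

include hcδ hδ hd hT₀ hJD in
/-- `|det_Δ p⁻¹|_v = |det_Δ p|_v⁻¹` on `P_Δ(F_v)`. [cite: HarrisKudlaSweet1996, §1 (1.15)] -/
theorem absDetDelta_inv {p : UnitaryGroup.localPi E c (n + n) JD v} (hp : IsSiegelDelta F E c hcδ hδ hd v n hT₀ hJD p) :
    absDetDelta F E c v n p⁻¹ = (absDetDelta F E c v n p)⁻¹ := by
  have h := absDetDelta_mul F E c hcδ hδ hd v n hT₀ hJD p p⁻¹ hp.inv
  rw [mul_inv_cancel, absDetDelta_one] at h
  exact (eq_inv_of_mul_eq_one_right h.symm)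

include hcδ hδ hd hT₀ hJD in
/-- `|det_Δ p|_v > 0` on `P_Δ(F_v)` (every `det_Δ p_w` is a unit, ★ `isUnit_detDelta`). [cite: HarrisKudlaSweet1996, §1 (1.15)] -/
theorem absDetDelta_pos {p : UnitaryGroup.localPi E c (n + n) JD v} (hp : IsSiegelDelta F E c hcδ hδ hd v n hT₀ hJD p) :
    0 < absDetDelta F E c v n p :=
  Finset.prod_pos fun w _ => norm_pos_iff.2 (isUnit_detDelta F E c hcδ hδ hd v n hT₀ hJD p hp w).ne_zero

/-- the scalar bookkeeping `x^n · (x⁻¹)^{s + n/2} = x^{−s + n/2}` for a real `x > 0`. [folklore] -/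
theorem pow_mul_inv_cpow {x : ℝ} (hx : 0 < x) (s : ℂ) (k : ℕ) :
    ((x ^ k : ℝ) : ℂ) * (((x⁻¹ : ℝ) : ℂ) ^ (s + (k : ℂ) / 2)) = ((x : ℂ)) ^ (-s + (k : ℂ) / 2) := by
  have hx0 : (x : ℂ) ≠ 0 := Complex.ofReal_ne_zero.2 hx.ne'
  have harg : (x : ℂ).arg ≠ Real.pi := by
    rw [Complex.arg_ofReal_of_nonneg hx.le]; exact Real.pi_ne_zero.symm
  rw [Complex.ofReal_pow, Complex.ofReal_inv, Complex.inv_cpow _ _ harg, ← Complex.cpow_neg, ← Complex.cpow_natCast,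
    ← Complex.cpow_add _ _ hx0]
  congr 1
  ring

include hT₀d in
/-- **THE LOCAL INTERTWINING PROPERTY, GIVEN THE MODULUS.**  Let `νN` be a left-invariant measure on `N_Δ(F_v)` whose push-forward under each
conjugation `u ↦ q u q⁻¹`, `q ∈ P_Δ(F_v)`, is `|det_Δ q|_v^{−n} • νN` (`hmod` — the module of `Ad(q)` on `N_Δ(F_v) ≅ Herm_n(E_v)`; organ Φ8a (B)),
`χ_w, χ′_w : E_wˣ →* ℂˣ` families with `χ′_w = (χ_{w′})⁻¹ ∘ c_w` whenever `c • w = w′` (`χ′ = (χ ∘ c)⁻¹`), and `f` a Siegel section of `I_v(s, χ_v)`.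
Then `M_v f = localIntertwining νN f` is a Siegel section of `I_v(−s, χ′_v)`:
`M_v f (p h) = χ′_v(det_Δ p) |det_Δ p|_v^{−s + n/2} · M_v f (h)` for all `p ∈ P_Δ(F_v)`, `h ∈ H(F_v)`.
Proof: `p = m · n₀` (§2); `u p = p (p⁻¹ u p)` and `hmod` at `p⁻¹` turn `∫ f(w_Δ u p h)` into `|det_Δ p|^{n} ∫ f(w_Δ p u h)`; `w_Δ p u = (w_Δ m w_Δ) · w_Δ (n₀ u)`
(`w_Δ² = 1`), the section law at `w_Δ m w_Δ ∈ P_Δ` (§3: character `χ′(det_Δ m)|det_Δ m|^{−(s+n/2)}`) and left invariance under `n₀` finish; no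
integrability is needed (a measurable equivalence, a scalar multiple of the measure, a left translation).
[cite: Casselman1980, §3] [cite: HarrisKudlaSweet1996, §1 (1.15), §6 (6.14)] [cite: MoeglinWaldspurger1995, II.1.6] -/
theorem isLocalSiegelSection_localIntertwining_of_modulus
    [MeasurableSpace (unipDeltaLocal F E c v n (JD := JD))] [BorelSpace (unipDeltaLocal F E c v n (JD := JD))]
    (νN : Measure (unipDeltaLocal F E c v n (JD := JD))) [νN.IsMulLeftInvariant]
    (hmod : ∀ (q : UnitaryGroup.localPi E c (n + n) JD v) (hq : IsSiegelDelta F E c hcδ hδ hd v n hT₀ hJD q),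
      Measure.map (fun u : unipDeltaLocal F E c v n (JD := JD) =>
        (⟨q * (u : UnitaryGroup.localPi E c (n + n) JD v) * q⁻¹, conj_mem_unipDeltaLocal F E c hcδ hδ hd v n hT₀ hJD hq u.2⟩ :
          unipDeltaLocal F E c v n (JD := JD))) νN =
        ENNReal.ofReal ((absDetDelta F E c v n q ^ n)⁻¹) • νN)
    (χv χv' : ∀ w : PlacesOver E v, (w.1.adicCompletion E)ˣ →* ℂˣ)
    (hχ' : ∀ (w w' : PlacesOver E v) (h : c • w.1 = w'.1),
      χv' w = (χv w')⁻¹.comp (Units.map (galAdicCompletionMap (L := E) c h : w.1.adicCompletion E →* w'.1.adicCompletion E)))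
    (s : ℂ) {φ : UnitaryGroup.localPi E c (n + n) JD v → ℂ} (hφ : IsLocalSiegelSection F E c hcδ hδ hd v n hT₀ hJD χv s φ) :
    IsLocalSiegelSection F E c hcδ hδ hd v n hT₀ hJD χv' (-s) (localIntertwining F E c v n hJD νN φ) := by
  classical
  intro p hp h
  have hC := (isSiegelDelta_iff_blkC_eq_zero F E c hcδ hδ hd v n hT₀ hJD p).1 hp
  -- the Levi decomposition `p = m · n₀`
  set n₀ : UnitaryGroup.localPi E c (n + n) JD v := nElem F E c v n hJD _ (skew_blkA_inv_mul_blkB F E c v n hJD hC) with hn₀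
  set m : UnitaryGroup.localPi E c (n + n) JD v := p * n₀⁻¹ with hm
  have hpm : p = m * n₀ := by rw [hm, inv_mul_cancel_right]
  have hn₀N : n₀ ∈ unipDeltaLocal F E c v n (JD := JD) := nElem_mem_unipDeltaLocal F E c v n hJD _ _
  have hn₀P : IsSiegelDelta F E c hcδ hδ hd v n hT₀ hJD n₀ := isSiegelDelta_nElem F E c hcδ hδ hd v n hT₀ hJD _ _
  have hmP : IsSiegelDelta F E c hcδ hδ hd v n hT₀ hJD m := hp.mul hn₀P.inv
  obtain ⟨-, hmB, hmC, -⟩ := blocks_matA_leviPart F E c v n hJD hC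
  have hwmw : IsSiegelDelta F E c hcδ hδ hd v n hT₀ hJD (weylDelta F E c v n hJD * m * weylDelta F E c v n hJD) :=
    isSiegelDelta_weylDelta_conj F E c hcδ hδ hd v n hT₀ hJD hmC hmB
  -- Step 1: `u p = p (p⁻¹ u p)` and the modulus at `p⁻¹`
  obtain ⟨e, he⟩ := exists_homeomorph_conj F E c hcδ hδ hd v n hT₀ hJD hp.inv
  have hmap : Measure.map e νN = ENNReal.ofReal ((absDetDelta F E c v n p⁻¹ ^ n)⁻¹) • νN := by
    rw [show (⇑e) = fun u : unipDeltaLocal F E c v n (JD := JD) =>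
        (⟨p⁻¹ * (u : UnitaryGroup.localPi E c (n + n) JD v) * p⁻¹⁻¹, conj_mem_unipDeltaLocal F E c hcδ hδ hd v n hT₀ hJD hp.inv u.2⟩ :
          unipDeltaLocal F E c v n (JD := JD)) from funext he]
    exact hmod p⁻¹ hp.inv
  have h1 : localIntertwining F E c v n hJD νN φ (p * h) =
      ∫ u, (fun u' : unipDeltaLocal F E c v n (JD := JD) =>
        φ (weylDelta F E c v n hJD * (p * (u' : UnitaryGroup.localPi E c (n + n) JD v)) * h)) (e u) ∂νN := by
    unfold localIntertwining
    refine integral_congr_ae (Filter.Eventually.of_forall fun u => ?_)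
    show φ (weylDelta F E c v n hJD * (u : UnitaryGroup.localPi E c (n + n) JD v) * (p * h)) =
      φ (weylDelta F E c v n hJD * (p * ((e u : unipDeltaLocal F E c v n (JD := JD)) : UnitaryGroup.localPi E c (n + n) JD v)) * h)
    rw [he u]
    show φ (weylDelta F E c v n hJD * (u : UnitaryGroup.localPi E c (n + n) JD v) * (p * h)) =
      φ (weylDelta F E c v n hJD * (p * (p⁻¹ * (u : UnitaryGroup.localPi E c (n + n) JD v) * p⁻¹⁻¹)) * h)
    congr 1
    rw [inv_inv]; group
  have h2 : ∫ u, (fun u' : unipDeltaLocal F E c v n (JD := JD) =>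
        φ (weylDelta F E c v n hJD * (p * (u' : UnitaryGroup.localPi E c (n + n) JD v)) * h)) (e u) ∂νN =
      (absDetDelta F E c v n p ^ n : ℝ) •
        ∫ u : unipDeltaLocal F E c v n (JD := JD), φ (weylDelta F E c v n hJD * (p * (u : UnitaryGroup.localPi E c (n + n) JD v)) * h) ∂νN := by
    have h := integral_map_equiv (μ := νN) e.toMeasurableEquiv (fun u' : unipDeltaLocal F E c v n (JD := JD) =>
      φ (weylDelta F E c v n hJD * (p * (u' : UnitaryGroup.localPi E c (n + n) JD v)) * h))
    rw [Homeomorph.toMeasurableEquiv_coe, hmap, integral_smul_measure,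
      ENNReal.toReal_ofReal (inv_nonneg.2 (pow_nonneg (absDetDelta_nonneg F E c v n _) _)), absDetDelta_inv F E c hcδ hδ hd v n hT₀ hJD hp,
      inv_pow, inv_inv] at h
    exact h.symm
  -- Step 2: `w_Δ p n₀⁻¹ u = (w_Δ m w_Δ) · (w_Δ u)`, the section law at `w_Δ m w_Δ`, left invariance under `n₀⁻¹`
  have hw2 := weylDelta_mul_self F E c v n hJD (T₀ := T₀)
  have key : ∀ a b b' : UnitaryGroup.localPi E c (n + n) JD v,
      weylDelta F E c v n hJD * a * weylDelta F E c v n hJD * (weylDelta F E c v n hJD * b * b') = weylDelta F E c v n hJD * (a * b) * b' := by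
    intro a b b'
    have h' : weylDelta F E c v n hJD * a * weylDelta F E c v n hJD * (weylDelta F E c v n hJD * b * b') =
        weylDelta F E c v n hJD * a * (weylDelta F E c v n hJD * weylDelta F E c v n hJD) * (b * b') := by simp only [mul_assoc]
    rw [h', hw2, mul_one]
    simp only [mul_assoc]
  have h3 : ∫ u : unipDeltaLocal F E c v n (JD := JD), φ (weylDelta F E c v n hJD * (p * (u : UnitaryGroup.localPi E c (n + n) JD v)) * h) ∂νN =
      localSiegelCharacter F E c v n χv s (weylDelta F E c v n hJD * m * weylDelta F E c v n hJD) *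
        localIntertwining F E c v n hJD νN φ h := by
    unfold localIntertwining
    rw [← integral_const_mul, ← integral_mul_left_eq_self (fun u : unipDeltaLocal F E c v n (JD := JD) =>
      φ (weylDelta F E c v n hJD * (p * (u : UnitaryGroup.localPi E c (n + n) JD v)) * h)) (⟨n₀, hn₀N⟩ : unipDeltaLocal F E c v n (JD := JD))⁻¹]
    refine integral_congr_ae (Filter.Eventually.of_forall fun u => ?_)
    show φ (weylDelta F E c v n hJD * (p * (n₀⁻¹ * (u : UnitaryGroup.localPi E c (n + n) JD v))) * h) =
      localSiegelCharacter F E c v n χv s (weylDelta F E c v n hJD * m * weylDelta F E c v n hJD) *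
        φ (weylDelta F E c v n hJD * (u : UnitaryGroup.localPi E c (n + n) JD v) * h)
    rw [← hφ _ hwmw, key, hm]
    congr 1
    simp only [mul_assoc]
  -- Step 3: the scalars
  rw [h1, h2, h3, Complex.real_smul, ← mul_assoc]
  congr 1
  unfold localSiegelCharacter
  rw [chiDet_weylDelta_conj F E c v n hT₀d hJD χv χv' hχ' hmC hmB, absDetDelta_weylDelta_conj F E c v n hT₀d hJD hmC hmB]
  have hχp : chiDet F E c v n χv' p = chiDet F E c v n χv' m := by
    rw [hpm, chiDet_mul F E c hcδ hδ hd v n hT₀ hJD χv' m n₀ hmP hn₀P, chiDet_eq_one_of_mem_unipDeltaLocal F E c v n χv' hn₀N, mul_one]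
  have hap : absDetDelta F E c v n p = absDetDelta F E c v n m := by
    rw [hpm, absDetDelta_mul F E c hcδ hδ hd v n hT₀ hJD m n₀ hn₀P, absDetDelta_eq_one_of_mem_unipDeltaLocal F E c v n hn₀N, mul_one]
  rw [hχp, hap, mul_left_comm, pow_mul_inv_cpow (absDetDelta_pos F E c hcδ hδ hd v n hT₀ hJD hmP) s n]

end Summit.HodgeConjecture.HodgeConjecture.Cruxes.HLiu418.K2LiuLocalIntertwiningProperty

end
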